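import Summits.BirchSwinnertonDyer.BirchSwinnertonDyer.Theorems.KimAtThreeShallowEqDeepAnomalousWitnessPairUnramified
import Summits.BirchSwinnertonDyer.BirchSwinnertonDyer.Theorems.KimAtThreeShallowEqDeepPortNonAddUnramified
import HarnessLib

/-!
# Route `KimAtThreeKolyvagin` (W2): the UNLOCKED Kato–Kurihara port at `3` from Kato's Euler system with the
# TWISTED (P-EXP) riders and value rows, WITHOUT `hbad` — ★ PK-6₂-u for the good ANOMALOUS rows
# (`a₃ ∈ {1, −2}`, `t = 0`)

Cell `bsd-addord`, seat `bsd-addord-w2-c4` (gen 9; owner of crux 19599 `ShallowEqDeepOffKatoStratum`, item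
19077 `ShallowEqDeepAtTorsionFree`).  `--supports` 19599.  HONEST FRAMING: ONE END THEOREM WITH DISPLAYED
HYPOTHESES (no definition, no named fact, no instance, no `sorry`): Kato's cited matrix `ZetaBody W 3 P.f …` on
displayed witnesses (`hbody`), the riders' (Λ)-clauses `hΛ` and TWISTED scalar clauses `hfinτ`
(`KimAtThreeShallowEqDeepAnomalousRider`; STATUS: true for Kato's witnesses by the seat's lattice lemma
`exp*_ω(H¹(K,T)) = E₃(φ⁻¹)·𝓞_K`, a derivation from [BK90] + formal groups — recorded there, not used in the
kernel), the auxiliary-datum side condition `hcdA`, THEOREM D-u's row certificate `ht0` at `3` (NO `hbad`: rows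
with a `3`-anomalous bad place included, w2-c3's D-u chain via (C2) of `ZetaBody`), and the TWISTED value rows
`hvalue` (`KimAtThreeShallowEqDeepAnomalousValueRowsOfZetaBody` discharges them from `hbody` at a good
`3 ∤ A·N`); nothing asserted, nothing booked; 19560 / 19599 / 19077 stay OPEN; BSD is not proved by any of this.
Credit: n1011-p13's ★ PK-6₂; the seat's gen-8 unlocked `hbad`-free form
`KimAtThreeShallowEqDeepPortNonAddUnramified.katoKuriharaPortUnlocked_zero_of_zetaBody_of_unramified` (p485031);
w2-c3's THEOREM D-u — this file is gen 8's §1 VERBATIM with the seat's twisted `hbad`-free WitnessPair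
(`KimAtThreeShallowEqDeepAnomalousWitnessPairUnramified`) in place of w2-c3's.

WHAT.  For all depths `k ≤ k′`, all `τ`-data canonical for the shared `η`, every pinned reduction, n1011's
witness clauses `KatoKuriharaWitnessAt W · 0 · v₃ P` at both depths + (COMP) — NO reduction-type hypothesis at
`3` (the reduction type enters only the riders and the value rows, here in their ANOMALOUS currency).  With gen
7's PortRows (ONE unlocked port at a tower row ⟹ upper / (R) / shallow = deep / lower / LEAF rows) this serves
19599 / 19077 / 19679 on the good anomalous rows; the sequel `KimAtThreeShallowEqDeepAnomalousFineKato` assembles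
it from the fine Kato package (C1_τ) and the certificates.  HONEST LIMITS as in ★ PK-6₂-u: `t = 0` only.

References: [Kato2004Asterisque] (8.1.3), §9.4, Thm. 9.7, Ex. 13.3; [Kim2022StructureSelmer] Thm. 3.13, §3.3–§3.4.1,
Lemma 3.4, Cor. 3.5; [MazurRubin2004] Def. 3.1.3, Thm. 3.2.4, App. A; [Sakamoto2024] §2, Def. 4.1; [Rubin2000]
Def. 4.4.4, Thm. 4.5.1; [BlochKato1990] §3.
-/

set_option autoImplicit false
-- the Theorems namespace of a single-conjunct summit repeats the summit name by design (D-0017)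
set_option linter.dupNamespace false

noncomputable section

open scoped NumberField TensorProduct ContRepresentation Classical
open CategoryTheory Field Function Finset IsDedekindDomain NumberField WeierstrassCurve
open Rat.HeightOneSpectrum
open Literature.NumberTheory.GaloisRepresentations Literature.NumberTheory.GaloisCohomology
open Literature.NumberTheory.GaloisRepresentations.DiscreteGaloisModule
open Literature.NumberTheory.EllipticCurves Literature.NumberTheory.EllipticCurves.ModularForms
open Literature.NumberTheory.EllipticCurves.Kato2004
open Literature.NumberTheory.EllipticCurves.Kato2004.EulerSystemValues

namespace Summit.BirchSwinnertonDyer.BirchSwinnertonDyer.Theorems.KimAtThreeShallowEqDeepAnomalousPortOfZetaBody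

open Summit.BirchSwinnertonDyer.Rank1Residual.GaloisImage
open Summit.BirchSwinnertonDyer.BirchSwinnertonDyer.Theorems

variable (W : WeierstrassCurve ℚ) [W.IsElliptic] [W.IsGloballyMinimal]
  [ContinuousSMul ℤ_[3] (W.tateModule 3)] [Module.Free ℤ_[3] (W.tateModule 3)]
  [Module.Finite ℤ_[3] (W.tateModule 3)]

set_option backward.isDefEq.respectTransparency false in
/-- **★ PK-6₂ UNLOCKED, TWISTED, WITHOUT `hbad`: the unlocked Kato–Kurihara port at `t = 0` from Kato's Euler
system, THEOREM D-u, the TWISTED riders and the TWISTED value rows — for the good ANOMALOUS rows at `3`**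
(module docstring).  Displayed: `hbody` for `P.f` at the conductor level, `(ap, hΛ, hfinτ)`, `hcdA`, `ht0`,
`hvalue` (twisted), surj(3), `v₃`; concluded: `KatoKuriharaWitnessAt W · 0 · v₃ P` at two depths + (COMP).
[cite: Kato2004Asterisque, (8.1.3) (p. 180), §9.4 (p. 188), Thm. 9.7 (p. 189) and Ex. 13.3 (pp. 224–225)]
[cite: Kim2022StructureSelmer, Thm. 3.13 and §1.2.2, §2.2.2, §3.3–§3.4.1 (arXiv v3 pp. 12, 17–18, 26–27)]
[cite: MazurRubin2004, Def. 3.1.3, Thm. 3.2.4 and App. A (Lemma A.1, Remark A.5)] [cite: Sakamoto2024, §2 and Def. 4.1] -/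
theorem katoKuriharaPortUnlocked_zero_of_zetaBody_of_unramified_twist
    {N : ℕ} [NeZero N] (P : ModularParametrizationData W N) (hN : N = W.conductorNorm ℤ)
    {ι : (n : ℕ) → (CyclotomicField n ℚ →+* ℂ)} {κK : ℝ}
    {Λ : ∀ (k' : ℕ) (r : Finset (HeightOneSpectrum (𝓞 ℚ))),
      H1 (tateRep W 3) (cycSubgroup 3 k' r) →ₗ[ℤ_[3]] ℚ_[3] ⊗[ℚ] CyclotomicField (cycLevel 3 k' r) ℚ}
    {c d a : ℤ} {A : ℕ}
    {z : ∀ (k' : ℕ) (r : (cyclotomicLevelsRat 3 (badPlaces c d A N)).Ideals),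
      H1 (tateRep W 3) ((cyclotomicLevelsRat 3 (badPlaces c d A N)).level k' r.1)}
    {x : ∀ (k' : ℕ) (r : (cyclotomicLevelsRat 3 (badPlaces c d A N)).Ideals),
      CyclotomicField (cycLevel 3 k' r.1) ℚ}
    (hbody : ZetaBody W 3 P.f ι κK Λ c d a A z x)
    {v₃ : HeightOneSpectrum (𝓞 ℚ)} (hv₃ : ((3 : ℕ) : 𝓞 ℚ) ∈ v₃.asIdeal)
    (hsurj : W.HasSurjectiveModNGaloisRep ((3 : ℕ) : ℤ))
    (Λfin : ∀ j : ℕ, galoisCohomology ((W.torsionGaloisModule (((3 : ℕ) : ℤ) ^ j * ((3 : ℕ) : ℤ))).toLocal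
      (Sum.inr v₃)) 1 →+ ZMod (3 ^ (j + 1))) (ap : ℤ)
    -- the riders' (Λ)-clauses (i) at every depth (DICT3's, verbatim)
    (hΛ : ∀ j : ℕ, (∀ c : ZMod (3 ^ (j + 1)), ∃ x ∈ propagatedSelmerStructure W 3 j (Sum.inr v₃), Λfin j x = c) ∧
      (∀ x ∈ propagatedSelmerStructure W 3 j (Sum.inr v₃),
        Λfin j x = 0 ↔ x ∈ W.kummerSelmerStructure (((3 : ℕ) : ℤ) ^ j * ((3 : ℕ) : ℤ)) (Sum.inr v₃)))
    -- the riders' TWISTED scalar clauses (ii_τ) at every depth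
    -- the ANOMALOUS rider's scalar clause (ii_τ): the premise is stated on the TWISTED lattice `(1 ⊗ P_w)·L_int`,
    -- `P_w = p − a_pδ_w + δ_{w²}`, `w·[p] = 1`, with the scalar `s·(p − a_p + 1) = s·#Ẽ(𝔽_p)`
    (hfinτ : ∀ j : ℕ, ∀ (r : Finset (HeightOneSpectrum (𝓞 ℚ))) (w : (ZMod (cycLevel 3 0 r))ˣ),
      (w : ZMod (cycLevel 3 0 r)) * ((3 : ℕ) : ZMod (cycLevel 3 0 r)) = 1 →
      ∀ (Ψ : H1 (tateRep W 3) (cycSubgroup 3 0 r) →+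
          continuousCohomology 1
            (subgroupRep (W.torsionGaloisModule (((3 : ℕ) : ℤ) ^ j * ((3 : ℕ) : ℤ))).toTopRep (cycSubgroup 3 0 r))),
        (∀ (φ : contOneCocycles (subgroupRep (tateRep W 3).toTopRep (cycSubgroup 3 0 r)))
            (ψ : contOneCocycles
              (subgroupRep (W.torsionGaloisModule (((3 : ℕ) : ℤ) ^ j * ((3 : ℕ) : ℤ))).toTopRep (cycSubgroup 3 0 r))),
            (∀ g, ((ψ.1 g : geomTorsion W (((3 : ℕ) : ℤ) ^ j * ((3 : ℕ) : ℤ))) : geomPoints W) =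
              TateModule.proj 3 (j + 1) (φ.1 g)) →
            Ψ (oneCocycleClass _ φ) = oneCocycleClass _ ψ) →
        ∀ (y : H1 (tateRep W 3) (cycSubgroup 3 0 r))
          (κ₀ : galoisCohomology (W.torsionGaloisModule (((3 : ℕ) : ℤ) ^ j * ((3 : ℕ) : ℤ))) 1) (s : ℤ_[3]),
          resSubgroup (W.torsionGaloisModule (((3 : ℕ) : ℤ) ^ j * ((3 : ℕ) : ℤ))).toTopRep (cycSubgroup 3 0 r) 1 κ₀ =
              Ψ y →
          galoisCohomology.localization (W.torsionGaloisModule (((3 : ℕ) : ℤ) ^ j * ((3 : ℕ) : ℤ))) (Sum.inr v₃) 1 κ₀ ∈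
              propagatedSelmerStructure W 3 j (Sum.inr v₃) →
          (∃ l ∈ cycIntLattice 3 (cycLevel 3 0 r),
              ((3 : ℕ) : ℤ_[3]) • Λ 0 r y -
                  (((s * (((3 : ℕ) : ℤ_[3]) - (ap : ℤ_[3]) + 1) : ℤ_[3]) : ℚ_[3]) ⊗ₜ[ℚ]
                    (1 : CyclotomicField (cycLevel 3 0 r) ℚ)) =
                ((3 : ℤ_[3]) ^ (j + 1)) • ∑ g : (ZMod (cycLevel 3 0 r))ˣ,
                  ((((((3 : ℕ) : MonoidAlgebra ℤ_[3] (ZMod (cycLevel 3 0 r))ˣ)) -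
                      MonoidAlgebra.single w (ap : ℤ_[3]) +
                      MonoidAlgebra.single (w ^ 2) (1 : ℤ_[3])).coeff g : ℤ_[3]) : ℚ_[3]) •
                    Algebra.TensorProduct.map (AlgHom.id ℚ ℚ_[3])
                      (sigma (cycLevel 3 0 r) g : CyclotomicField (cycLevel 3 0 r) ℚ →ₐ[ℚ]
                        CyclotomicField (cycLevel 3 0 r) ℚ) l) →
          Λfin j (galoisCohomology.localization (W.torsionGaloisModule (((3 : ℕ) : ℤ) ^ j * ((3 : ℕ) : ℤ)))
              (Sum.inr v₃) 1 κ₀) = PadicInt.toZModPow (j + 1) s)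
    {η : (q : HeightOneSpectrum (𝓞 ℚ)) → (ZMod (Ideal.absNorm q.asIdeal))ˣ}
    -- the auxiliary datum avoids every prime `≡ 1 (mod 3)` (so every Kolyvagin prime is usable)
    (hcdA : ∀ q : ℕ, q.Prime → q ≡ 1 [MOD 3] → ¬ q ∣ 2 * c.natAbs * d.natAbs * A)
    -- THEOREM D-u's row certificate at `3` only (`t = 0`); NO `hbad`
    (ht0 : ∀ w : HeightOneSpectrum (𝓞 ℚ), ((3 : ℕ) : 𝓞 ℚ) ∈ w.asIdeal →
        ∀ Q : (W.baseChange (w.adicCompletion ℚ)).toAffine.Point, 3 • Q = 0 → Q = 0)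
    -- the per-level VALUE ROWS (T-PK6-VROW's OUT), displayed
    (hvalue : ∀ (j : ℕ) (σ : HeightOneSpectrum (𝓞 ℚ) → absoluteGaloisGroup ℚ),
      (∀ q, σ q ∈ (adicCompletionPrime ℚ q).inertia (absoluteGaloisGroup ℚ)) →
      (∀ q, modNCyclotomicCharacter ℚ (Ideal.absNorm q.asIdeal) (σ q) = η q) →
      ∀ (r : Finset (HeightOneSpectrum (𝓞 ℚ)))
        (hr : ∀ q ∈ r, q ∈ (cyclotomicLevelsRat 3 (badPlaces c d A N)).primes),
        (∀ q ∈ r, Kato.IsKolyvaginPrime W 3 (j + 1) ((primesEquiv q : Nat.Primes) : ℕ)) →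
        (∀ q ∈ r, Subgroup.zpowers (η q) = ⊤) →
        ∃ (w : (ZMod (cycLevel 3 0 r))ˣ), (w : ZMod (cycLevel 3 0 r)) * ((3 : ℕ) : ZMod (cycLevel 3 0 r)) = 1 ∧
        ∃ (s : ℤ_[3]) (u : (ZMod (3 ^ (j + 1)))ˣ)
          (ψ : (ℓ : ℕ) → (ZMod ℓ)ˣ →* Multiplicative (ZMod (3 ^ (j + 1)))),
          (∀ q ∈ r, Function.Surjective (ψ (Ideal.absNorm q.asIdeal))) ∧
          (∃ l ∈ cycIntLattice 3 (cycLevel 3 0 r),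
            ((3 : ℕ) : ℤ_[3]) • ((1 : ℚ_[3]) ⊗ₜ[ℚ]
              ((r.noncommProd (fun ℓ : HeightOneSpectrum (𝓞 ℚ) =>
                  ∑ j ∈ Finset.range (((primesEquiv ℓ : Nat.Primes) : ℕ) - 1),
                    (j : Module.End ℚ (CyclotomicField (cycLevel 3 0 r) ℚ)) *
                      (sigma (cycLevel 3 0 r) (modNCyclotomicCharacter ℚ (cycLevel 3 0 r) (σ ℓ)) :
                        CyclotomicField (cycLevel 3 0 r) ℚ →ₐ[ℚ]
                          CyclotomicField (cycLevel 3 0 r) ℚ).toLinearMap ^ j)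
                (ZetaValue.pairwise_commute_fieldDeriv (cycLevel 3 0 r)
                  (fun ℓ => modNCyclotomicCharacter ℚ (cycLevel 3 0 r) (σ ℓ))
                  (fun ℓ => ((primesEquiv ℓ : Nat.Primes) : ℕ) - 1) r))
                (x 0 ⟨r, hr⟩ + sigma (cycLevel 3 0 r) (-1) (x 0 ⟨r, hr⟩)))) -
              (((s * (((3 : ℕ) : ℤ_[3]) - (ap : ℤ_[3]) + 1) : ℤ_[3]) : ℚ_[3]) ⊗ₜ[ℚ]
                (1 : CyclotomicField (cycLevel 3 0 r) ℚ)) =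
            (((3 : ℕ) : ℤ_[3]) ^ (j + 1)) • ∑ g : (ZMod (cycLevel 3 0 r))ˣ,
              ((((((3 : ℕ) : MonoidAlgebra ℤ_[3] (ZMod (cycLevel 3 0 r))ˣ)) -
                  MonoidAlgebra.single w (ap : ℤ_[3]) +
                  MonoidAlgebra.single (w ^ 2) (1 : ℤ_[3])).coeff g : ℤ_[3]) : ℚ_[3]) •
                Algebra.TensorProduct.map (AlgHom.id ℚ ℚ_[3])
                  (sigma (cycLevel 3 0 r) g : CyclotomicField (cycLevel 3 0 r) ℚ →ₐ[ℚ]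
                    CyclotomicField (cycLevel 3 0 r) ℚ) l) ∧
          haveI : NeZero (∏ q ∈ r, Ideal.absNorm q.asIdeal) :=
            ⟨Finset.prod_ne_zero_iff.2 fun q _ h => q.ne_bot (Ideal.absNorm_eq_zero_iff.1 h)⟩
          PadicInt.toZModPow (j + 1) s = (u : ZMod (3 ^ (j + 1))) *
            ((3 : ℕ) : ZMod (3 ^ (j + 1))) ^ (0 : ℕ) *
              kuriharaNumber P.f (3 ^ (j + 1)) (∏ q ∈ r, Ideal.absNorm q.asIdeal) ψ) :
    ∀ (k k' : ℕ) (D : KolyvaginDatum (W.torsionGaloisModule (((3 : ℕ) : ℤ) ^ k * ((3 : ℕ) : ℤ))))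
      (D' : KolyvaginDatum (W.torsionGaloisModule (((3 : ℕ) : ℤ) ^ k' * ((3 : ℕ) : ℤ))))
      (red : (W.torsionGaloisModule (((3 : ℕ) : ℤ) ^ k' * ((3 : ℕ) : ℤ))).toContRepresentation →ⁱL
        (W.torsionGaloisModule (((3 : ℕ) : ℤ) ^ k * ((3 : ℕ) : ℤ))).toContRepresentation),
      D.IsCanonicalTauDatumThreeAtWith W k k η → D'.IsCanonicalTauDatumThreeAtWith W k' k' η → k ≤ k' →
      (∀ y : geomTorsion W (((3 : ℕ) : ℤ) ^ k' * ((3 : ℕ) : ℤ)),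
        ((red y : geomTorsion W (((3 : ℕ) : ℤ) ^ k * ((3 : ℕ) : ℤ))) : geomPoints W) =
          (((3 : ℕ) : ℤ) ^ (k' - k)) • (y : geomPoints W)) →
      ∃ κ Λ₀ κ' κu Λu κu',
        KatoKuriharaWitnessAt W k 0 D v₃ P κ Λ₀ κ' ∧ KatoKuriharaWitnessAt W k' 0 D' v₃ P κu Λu κu' ∧
        ∀ e, D'.IsLevel e → D.IsLevel e →
          galoisCohomology.map red 1 (κu e) = κ e ∧ galoisCohomology.map red 1 (κu' e) = κ' e := by
  intro k k' D D' red hDW hDW' hkk' hred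
  -- the guards
  obtain ⟨hT, hC, S, τ, hS, hτμ, hτq, hP⟩ := hDW
  obtain ⟨hT', hC', S', τ', hS', hτμ', hτq', hP'⟩ := hDW'
  have hirr : W.HasIrreducibleModPGaloisRep 3 :=
    hasIrreducibleModPGaloisRep_of_hasSurjectiveModNGaloisRep W 3 hsurj
  -- Kolyvagin primes of the right levels (E1-deep on the deep classes of the guards)
  have hKol : ∀ q ∈ D.primes, Kato.IsKolyvaginPrime W 3 (k + 1) ((primesEquiv q : Nat.Primes) : ℕ) :=
    fun q hq => KolyvaginPrime.isKolyvaginPrime_of_mem_frobeniusClassPrimes_of_le W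
      (Nat.le_add_right k 0) (fun v hv => (hS v hv).1) hτμ hτq (hP hq)
  have hKol' : ∀ q ∈ D'.primes, Kato.IsKolyvaginPrime W 3 (k' + 1) ((primesEquiv q : Nat.Primes) : ℕ) :=
    fun q hq => KolyvaginPrime.isKolyvaginPrime_of_mem_frobeniusClassPrimes_of_le W
      (Nat.le_add_right k' 0) (fun v hv => (hS' v hv).1) hτμ' hτq' (hP' hq)
  -- every Kolyvagin prime is a usable prime of Kato's system for `(c, d, A, N)`
  have husable : ∀ (j : ℕ) (q : HeightOneSpectrum (𝓞 ℚ)),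
      Kato.IsKolyvaginPrime W 3 (j + 1) ((primesEquiv q : Nat.Primes) : ℕ) →
        q ∈ (cyclotomicLevelsRat 3 (badPlaces c d A N)).primes := by
    intro j q hq
    have hℓ := hq.prime
    have h13 : ((primesEquiv q : Nat.Primes) : ℕ) ≡ 1 [MOD 3] :=
      hq.modEq_one.of_dvd (dvd_pow_self 3 (Nat.succ_ne_zero j))
    refine (mem_primes_cyclotomicLevelsRat_badPlaces_iff 3 c d A N q).2 ⟨fun hdvd => ?_, hq.ne⟩
    rcases (Nat.Prime.dvd_mul hℓ).mp hdvd with h | h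
    · exact hcdA _ hℓ h13 h
    · apply hq.not_dvd
      rw [← hN]
      exact dvd_mul_of_dvd_left h 3
  have hPr : D.primes ⊆ (cyclotomicLevelsRat 3 (badPlaces c d A N)).primes :=
    fun q hq => husable k q (hKol q hq)
  have hPr' : D'.primes ⊆ (cyclotomicLevelsRat 3 (badPlaces c d A N)).primes :=
    fun q hq => husable k' q (hKol' q hq)
  -- `𝓕_can,3 = ⊤` at every depth (`t = 0`, Mazur–Rubin Lemma A.1 along the reduction tower)
  have htower : ∀ j : ℕ,
      ∃ redj : (W.torsionGaloisModule (((3 : ℕ) : ℤ) ^ (j + 1) * ((3 : ℕ) : ℤ))).toContRepresentation →ⁱL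
          (W.torsionGaloisModule (((3 : ℕ) : ℤ) ^ j * ((3 : ℕ) : ℤ))).toContRepresentation,
        ∀ y : geomTorsion W (((3 : ℕ) : ℤ) ^ (j + 1) * ((3 : ℕ) : ℤ)),
          ((redj y : geomTorsion W (((3 : ℕ) : ℤ) ^ j * ((3 : ℕ) : ℤ))) : geomPoints W) =
            ((3 : ℕ) : ℤ) • (y : geomPoints W) := by
    intro j
    obtain ⟨redj, hredj⟩ := exists_torsionReduction_three W j (j + 1)
    refine ⟨redj, fun y => ?_⟩
    rw [hredj, Nat.add_sub_cancel_left, pow_one]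
  choose redT hredT using htower
  have htop : ∀ (j : ℕ) (w : HeightOneSpectrum (𝓞 ℚ)), ((primesEquiv w : Nat.Primes) : ℕ) = 3 →
      propagatedSelmerStructure W 3 j (Sum.inr w) = ⊤ := by
    intro j w hw
    have hw3 : ((3 : ℕ) : 𝓞 ℚ) ∈ w.asIdeal := KolyvaginPrime.natCast_mem_asIdeal_of_primesEquiv_eq hw
    exact propagatedSelmerStructure_three_eq_top_of_torsion_eq_zero W w hw3 (ht0 w hw3) redT hredT j
  -- the witness package at the two depths + (COMP) WITHOUT `hbad` (the seat's T-PK62-PAIR-u on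
  -- THEOREM D-u), value rows from `hvalue`
  obtain ⟨κf, κu, h₁, h₂, h₃⟩ :=
    KimAtThreeShallowEqDeepAnomalousWitnessPairUnramified.exists_katoKuriharaWitnessAt_pair_of_zetaBody_of_unramified_twist
      W P hbody hirr hkk' red hred hv₃ ap (hΛ k) (hΛ k') (hfinτ k) (hfinτ k') D hT D' hT' hC hC' hPr hPr' hKol
      hKol' (htop k) (htop k')
      (fun σ hI hχ r hr => hvalue k σ hI hχ r (fun q hq => hPr (hr (Finset.mem_coe.2 hq)))
        (fun q hq => hKol q (hr (Finset.mem_coe.2 hq)))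
        (fun q hq => hC.zpowers_eq_top (hr (Finset.mem_coe.2 hq))))
      (fun σ hI hχ r hr => hvalue k' σ hI hχ r (fun q hq => hPr' (hr (Finset.mem_coe.2 hq)))
        (fun q hq => hKol' q (hr (Finset.mem_coe.2 hq)))
        (fun q hq => hC'.zpowers_eq_top (hr (Finset.mem_coe.2 hq))))
  exact ⟨κf, Λfin k, κf, κu, Λfin k', κu, h₁, h₂, fun e he' he => ⟨h₃ e he' he, h₃ e he' he⟩⟩

end Summit.BirchSwinnertonDyer.BirchSwinnertonDyer.Theorems.KimAtThreeShallowEqDeepAnomalousPortOfZetaBody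

end
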